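import Summits.QuantumFields.YangMills.Theorems.BalabanUVNodesN11TStepBranchSumAtRecord13OfLaws

/-!
# DAG node N11 — THE GRAPH-INTEGRABILITY ROW `hG` OF THE (O3′) PRODUCER IS A THEOREM OF THE CORE PROVISOS: def-T's `TStepProvisos` (`intPiece`, `measW`, `absW_le`) give
# `Integrable (U ↦ w(s′)(U,Ū)·χ_k(init s′)(U)·slot_k(init s′)(U))`; (O3′) on the nose ∕ the (O3′) disjunction in the Stage-13 letters `_of_provisos`

HEADER — WORK-UNIT METADATA.  Cell `pub-ymgap`, YM-PLAN Track A (HUMAN RULING D-0062 ∕ D-0149), width seat `pub-ymgap-dag-n11-w2` (g4; WIDTH SEAT 2∕4 on N11 [B14]),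
route `BalabanUVNodes`; this seat's jail key is K1⁷ `stmt-QuantumFields-20542` (`--kind proof --supports 20542 --as helper`, count-neutral); the K1 face of record since
KEY MAP v2 is K1⁹ `StabilityBRunRowsAtRecordR13SepCoPHV` = stmt-QuantumFields-27364 (MIS-KEY ∕ VALID rule R463 (4)(a): lineage BY NAME).  [III] = [Balaban1988Convergent].
Sequel of this seat's `…N11TStepBranchSumAtRecord13OfLaws` (p626903: (O3′) on the nose in the Stage-13 letters `_of_laws` ∕ `_of_rows`, NO `hint`, `hgm` ⟸ rows), over def-T's
`Node00/TStepOfRecord` (`integrable_graph_piece`), `Node00/RepTowerOfRecord` (`TStepProvisos`: rows `intPiece` ∕ `measW` ∕ `absW_le`), `Node00/DatumAvLayer`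
(`avOfRecord_measurable`) and def-T v1.7 `Node00/Record13CoPH` (`Stage13HParams.Provisos₁₃CoPH.tstep`, `.zhLaws`).  Bus: CLAIM-2 of g4.

WHY THIS FILE.  Every file of the (O3′) road — dag-n11-d's p616225 ∕ p619836 ∕ p620817 ∕ p622584 ∕ p623644 ∕ `…TStepOldBranchGraphIntegrable` and this seat's p622291 ∕ p624357 ∕
p626903 — displays «def-T's graph integrability of the step» `hG : Integrable (U ↦ w(s′)(U, Ū)·(χ_k(init s′)(U)·slot_k(init s′)(U))) dU`.  It is NOT an independent row: def-T's
step provisos `TStepProvisos … p g k` (the level-`k` pieces `χ_k(s)·slot_k(s)` are integrable, the step weights are jointly measurable in `(V′, U)` and bounded by `1`) give it by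
def-T's own `integrable_graph_piece` (an integrable function times a bounded jointly measurable cofactor read on the graph of the averaging of record), and at a v1.7 parameter
the step provisos are a THEOREM of the core provisos (`Stage13HParams.Provisos₁₃CoPH.tstep`: rows `intPiece`, `measω`, `zetaAbs`, `measChi`, `zetaUnity`), which every consumer
of the (O3′) road already holds.  So, composed with p626903, the (O3′) producer at a 𝐓-present expansion child reads from `θ.Provisos₁₃CoPH` + two residual-measurability rows +
one operand row + the chart content (`hin` ∕ `hinnerSum`) ONLY.

WHAT THIS FILE PROVES (0 `sorry`, 0 `def`, standard axioms).
§1 ★ `integrable_graph_of_tstepProvisos` (11a ∕ def-T letters: `TStepProvisos F N ν τ E w ppSel p g k` ⟹ the `hG` row for EVERY history `s′` of length `k+1`).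
§2 ★★ `hG_at_record₁₃_of_provisos` (Stage-13 letters: `θ.Provisos₁₃CoPH F N`, `k < K` ⟹ the `hG` row of p620817 ∕ p626903 ∕ `…TStepOldBranchGraphIntegrable` §3 VERBATIM).
§3 ★★★ `slotsTOfRecord₁₃H_succ_ae_eq_sect2Slot_of_innerSum_of_provisos` (p626903's `_of_rows` with `hG` AND `hZ` discharged from `θ.Provisos₁₃CoPH`) · ★★★
`slotsTOfRecord₁₃H_succ_O3_of_innerSum_of_provisos` (the (O3′) DISJUNCTION of dag-n11-e's `…N11Sect3SupplyChainDefs.PresentChildObligations` VERBATIM — right disjunct, `χ_{k+1}`-guard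
dropped — from `θ.Provisos₁₃CoPH`, the two residual-measurability rows `hζ` ∕ `hq`, the operand row `hΦm`, and the chart content `hFm` ∕ `hin` ∕ `hinnerSum`).

HONEST FRAMING.  Helper lane, count-neutral; [folklore] `Integrable.mul_bdd` bookkeeping over def-T's OWN step provisos BY NAME; nothing of def-T ∕ dag-n11-d ∕ p626903 re-typed.
`hin` ∕ `hinnerSum` DISPLAYED (no claim that any witness satisfies them — THE CHARTED INNER SUM is where [I] §2 ∕ [III] §3 ∕ Thm 2 live); NO chart of Bałaban's, NO Jacobian, NO
Gaussian integration asserted; (B4) ∕ (S-α) ∕ (O3′) NOT closed; N11 NOT discharged; K1⁹ NOT closed, no registered stub touched; counts unmoved (typed 28∕28 · discharged 5∕27 · A 5∕28).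
One finite `𝕋⁴_{L^K}` programme at fixed `ε = L^{−K}`; R4 closes only the conditional finite-𝕋⁴ rung `BalabanLadder.UV` — NOT ℝ⁴, NOT OS, NOT a mass gap, NOT Clay.  No `sorry`,
`axiom`, `def`, `instance`, `notation`.  Sources (SHAPE ∕ bookkeeping only): [III] (2.18) p.257, (3.1) p.264, (3.2)–(3.9) pp.265–266, (3.16) p.268, (3.24)–(3.25) p.270, §3 p.279.
-/

noncomputable section

open MeasureTheory ProbabilityTheory
open scoped ENNReal NNReal BigOperators Matrix.Norms.L2Operator

namespace Summit.QuantumFields.YangMills.Theorems.BalabanUVNodesN11TStepGraphIntegrableOfProvisos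

open Literature.MathematicalPhysics.QuantumFieldTheory.Balaban1983to89
open Literature.MathematicalPhysics.QuantumFieldTheory.Balaban1983to89.T4AveragingDisintegration
open BalabanUVNodesN11TStepBranchSumAtRecord13OfLaws (slotsTOfRecord₁₃H_succ_ae_eq_sect2Slot_of_innerSum_of_rows)
open Node00 hiding SU
open Node00.Tk T4Continuum
open B10Eq42TorusConstraint (bondsIn)

/-! ## §1  def-T's step provisos give the graph-integrability row, every history (generic letters) -/

section Generic

variable (F : T4Family) (N : ℕ) [NeZero N]

/-- ★ **THE `hG` ROW FROM def-T's STEP PROVISOS**: under `TStepProvisos F N ν τ E w ppSel p g k` (the level-`k` pieces `χ_k(s)·slot_k(s)` integrable, the step weights jointly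
measurable and `|w| ≤ 1`), for EVERY history `s′` of length `k+1` the graph integrand `U ↦ w(s′)(U, Ū)·(χ_k(init s′)(U)·slot_k(init s′)(U))` is `dU`-integrable — def-T's
`integrable_graph_piece` at the averaging of record (`avOfRecord_measurable`), the factors commuted. [cite: Balaban1988Convergent, (3.1) p.264, (3.2)–(3.3) p.265, (3.24)–(3.25) p.270 (bookkeeping)] -/
theorem integrable_graph_of_tstepProvisos (ν : Stage7Numerics) (τ : TowerNumerics) (E : B12.RunParams → ℝ) (w : StepWeightsOfRecord F N ν τ.M)
    (ppSel : PpSelOfRecord F ν τ.M) (p : B12.RunParams) (g : ℕ → ℝ) {k : ℕ} (hT : TStepProvisos F N ν τ E w ppSel p g k)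
    (s' : SeqOfRecord F ν τ.M g p.K (k + 1)) :
    Integrable (fun U => w p g k s' U ((avOfRecord F N p.K k).avg U) *
      (chiSeqOfRecord F N ν τ.M g p.K k s'.init U * slotsOfRecord F N ν τ E w ppSel p g k s'.init U)) (fieldMeasure (F.P p.K) k (SU N)) := by
  have h := integrable_graph_piece (avOfRecord_measurable F N p.K k) (hT.intPiece s'.init) (hT.measW s') (C := 1)
    (fun z => by rw [Real.norm_eq_abs]; exact hT.absW_le s' z.2 z.1)
  exact h.congr (Filter.Eventually.of_forall fun U => mul_comm _ _)

end Generic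

/-! ## §2  At a v1.7 parameter: the `hG` row from the core provisos -/

section Record

variable {F : T4Family} {N : ℕ} [NeZero N]

/-- ★★ **THE `hG` ROW OF THE (O3′) ROAD IS A THEOREM OF THE CORE PROVISOS**: at `θ : Stage13HParams` with `θ.Provisos₁₃CoPH F N`, run `p`, step `k < K` and ANY history `s′` of
length `k+1`, `U ↦ w(s′)(U, Ū)·(χ_k(init s′)(U)·slot_k(init s′)(U))` is integrable — the `hG` binder of dag-n11-d's p616225 ∕ p619836 ∕ p620817 ∕ p623644 ∕ `…TStepOldBranchGraphIntegrable`
§3 and of this seat's p622291 ∕ p624357 ∕ p626903, VERBATIM.  §1 at `Stage13HParams.Provisos₁₃CoPH.tstep` (rows `intPiece`, `measω`, `zetaAbs`, `measChi`, `zetaUnity`).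
[cite: Balaban1988Convergent, (3.1) p.264, (3.2)–(3.9) pp.265–266, (3.16) p.268, (3.24)–(3.25) p.270 (bookkeeping)] -/
theorem hG_at_record₁₃_of_provisos (θ : Stage13HParams F N) (h : θ.Provisos₁₃CoPH F N) (p : B12.RunParams) {k : ℕ} (hkK : k < p.K)
    (s' : SeqOfRecord F θ.ν θ.τ9.M (gOfRecord₁₃ F N θ.toStage13Params p) p.K (k + 1)) :
    Integrable (fun U => wOfRecord₉ F N θ.toStage9Params p (gOfRecord₁₃ F N θ.toStage13Params p) k s' U ((avOfRecord F N p.K k).avg U) *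
      (chiSeqOfRecord F N θ.ν θ.τ9.M (gOfRecord₁₃ F N θ.toStage13Params p) p.K k s'.init U *
        slotsOfRecord F N θ.ν θ.τ9 (EOfRecord₁₃ F N θ.toStage13Params) (wOfRecord₉ F N θ.toStage9Params) θ.ppSel p (gOfRecord₁₃ F N θ.toStage13Params p) k s'.init U))
      (fieldMeasure (F.P p.K) k (SU N)) :=
  integrable_graph_of_tstepProvisos F N θ.ν θ.τ9 (EOfRecord₁₃ F N θ.toStage13Params) (wOfRecord₉ F N θ.toStage9Params) θ.ppSel p
    (gOfRecord₁₃ F N θ.toStage13Params p) (h.tstep p k hkK) s'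

end Record

/-! ## §3  (O3′) on the nose ∕ the (O3′) disjunction in the Stage-13 letters `_of_provisos` -/

section OnTheNose

variable {F : T4Family} {N : ℕ} [NeZero N]

/-- ★★★ **(O3′) ON THE NOSE IN THE STAGE-13 LETTERS, `_of_provisos`**: p626903's `slotsTOfRecord₁₃H_succ_ae_eq_sect2Slot_of_innerSum_of_rows` with `hG` (§2) AND the residual law `hZ`
(row `zhLaws`) DISCHARGED from `θ.Provisos₁₃CoPH F N`: for ANY proposed `(t′, E′)`, `slotsTOfRecord … (k+1) s′ =ᵐ[dV′] sect2Slot … (WtOfRecord₁₃H θ p s′) s′ t′ E′ (UbgOfRecord₁₃CoP … (k+1) s′)`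
modulo the two residual-measurability rows `hζ` ∕ `hq` (the residual serving `s′`), the operand row `hΦm`, and the chart content `hFm` ∕ `hin` ∕ `hinnerSum` (DISPLAYED; [I] §2 ∕ [III] §3 ∕
Thm 2 live in `hinnerSum`). [cite: Balaban1988Convergent, (2.18) p.257, (2.20)–(2.23) p.258, (3.1) p.264, (3.16)–(3.25) pp.268–270, §3 p.279] -/
theorem slotsTOfRecord₁₃H_succ_ae_eq_sect2Slot_of_innerSum_of_provisos (θ : Stage13HParams F N) (h : θ.Provisos₁₃CoPH F N)
    (p : B12.RunParams) {k : ℕ} (hkK : k < p.K)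
    {hdec : DecidableEq (PBond (F.P p.K) k)} {hdec' : DecidableEq (PBond (F.P p.K) (k + 1))} (hk : k + 1 ≤ (F.P p.K).m + (F.P p.K).K)
    (s' : SeqOfRecord F θ.ν θ.τ9.M (gOfRecord₁₃ F N θ.toStage13Params p) p.K (k + 1))
    (t' : Sect2.TermValues (F.P p.K) (MatA N) (FluctV N) θ.τ9.M) (E' : ℝ)
    (hζ : ∀ (j : ℕ) (Y : Set (Site (F.P p.K) 0)), Measurable ((θ.zhAt p s').ζ0 j Y))
    (hq : ∀ (j : ℕ) (Λ' : Set (Site (F.P p.K) 0)), Measurable ((θ.zhAt p s').quad j Λ'))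
    (hΦm : ∀ S ∈ admSOfRecord F θ.ν θ.τ9.M (gOfRecord₁₃ F N θ.toStage13Params p) p.K (k + 1) s',
      Measurable (fun ω : MultiCfg (F.P p.K) (SU N) (FluctV N) =>
        sect2Operand F N (FluctV N) p.K (settingOfRecord₁₃ F N θ.toStage13Params p) (θ.rzAt p s') s' t' E'
          (UbgOfRecord₁₃CoP F N θ.toStage13Params p (k + 1) s') (S, fun j => (ω j).2) (fun j => (ω j).1)))
    {Fᵢ : (↥(Set.toFinite (bondsIn k (s'.Ω (k + 1))ᶜ)).toFinset → SU N) ×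
        ({c : PBond (F.P p.K) (k + 1) // c ∉ (Set.toFinite (bondsIn (k + 1) (s'.Ω (k + 1))ᶜ)).toFinset} → SU N) → ℝ} (hFm : Measurable Fᵢ)
    (hin : kernelTransport
        ((Measure.pi fun _ : ↥(Set.toFinite (bondsIn k (s'.Ω (k + 1))ᶜ)).toFinset => (HaarData.haar : Measure (SU N))).prod
          (Measure.pi fun _ : {b : PBond (F.P p.K) k // b ∉ (Set.toFinite (bondsIn k (s'.Ω (k + 1))ᶜ)).toFinset} => (HaarData.haar : Measure (SU N))))
        ((Measure.pi fun _ : ↥(Set.toFinite (bondsIn k (s'.Ω (k + 1))ᶜ)).toFinset => (HaarData.haar : Measure (SU N))).prod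
          (Measure.pi fun _ : {c : PBond (F.P p.K) (k + 1) // c ∉ (Set.toFinite (bondsIn (k + 1) (s'.Ω (k + 1))ᶜ)).toFinset} =>
            (HaarData.haar : Measure (SU N))))
        (fun q => (q.1, fun c : {c : PBond (F.P p.K) (k + 1) // c ∉ (Set.toFinite (bondsIn (k + 1) (s'.Ω (k + 1))ᶜ)).toFinset} =>
          (avOfRecord F N p.K k).avg
            ((MeasurableEquiv.piEquivPiSubtypeProd (fun _ : PBond (F.P p.K) k => SU N)
              (· ∈ (Set.toFinite (bondsIn k (s'.Ω (k + 1))ᶜ)).toFinset)).symm q) c))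
        ((fun U => wOfRecord₉ F N θ.toStage9Params p (gOfRecord₁₃ F N θ.toStage13Params p) k s' U ((avOfRecord F N p.K k).avg U) *
            (chiSeqOfRecord F N θ.ν θ.τ9.M (gOfRecord₁₃ F N θ.toStage13Params p) p.K k s'.init U *
              slotsOfRecord F N θ.ν θ.τ9 (EOfRecord₁₃ F N θ.toStage13Params) (wOfRecord₉ F N θ.toStage9Params) θ.ppSel p
                (gOfRecord₁₃ F N θ.toStage13Params p) k s'.init U)) ∘
          ⇑(MeasurableEquiv.piEquivPiSubtypeProd (fun _ : PBond (F.P p.K) k => SU N)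
            (· ∈ (Set.toFinite (bondsIn k (s'.Ω (k + 1))ᶜ)).toFinset)).symm)
      =ᵐ[(Measure.pi fun _ : ↥(Set.toFinite (bondsIn k (s'.Ω (k + 1))ᶜ)).toFinset => (HaarData.haar : Measure (SU N))).prod
          (Measure.pi fun _ : {c : PBond (F.P p.K) (k + 1) // c ∉ (Set.toFinite (bondsIn (k + 1) (s'.Ω (k + 1))ᶜ)).toFinset} =>
            (HaarData.haar : Measure (SU N)))] Fᵢ)
    (hinnerSum : ∀ᵐ q ∂((Measure.pi fun _ : ↥(Set.toFinite (bondsIn (k + 1) (s'.Ω (k + 1))ᶜ)).toFinset => (HaarData.haar : Measure (SU N))).prod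
          (Measure.pi fun _ : {c : PBond (F.P p.K) (k + 1) // c ∉ (Set.toFinite (bondsIn (k + 1) (s'.Ω (k + 1))ᶜ)).toFinset} =>
            (HaarData.haar : Measure (SU N)))),
      ∀ y : ↥(Set.toFinite (bondsIn k (s'.Ω (k + 1))ᶜ)).toFinset → SU N,
        avgRestrOfRecord F N p.K k (Set.toFinite (bondsIn k (s'.Ω (k + 1))ᶜ)).toFinset (Set.toFinite (bondsIn (k + 1) (s'.Ω (k + 1))ᶜ)).toFinset y = q.1 →
        Fᵢ (y, q.2) =
          ∑ S ∈ admSOfRecord F θ.ν θ.τ9.M (gOfRecord₁₃ F N θ.toStage13Params p) p.K (k + 1) s',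
            zetaOp (genDataOfRecord F N (FluctV N) θ.ν θ.τ9.M (gOfRecord₁₃ F N θ.toStage13Params p) p.K (WtOfRecord₁₃H F N θ p s') s' S k).ζ
              (aOp k (genDataOfRecord F N (FluctV N) θ.ν θ.τ9.M (gOfRecord₁₃ F N θ.toStage13Params p) p.K (WtOfRecord₁₃H F N θ p s') s' S k).sA
                (genDataOfRecord F N (FluctV N) θ.ν θ.τ9.M (gOfRecord₁₃ F N θ.toStage13Params p) p.K (WtOfRecord₁₃H F N θ p s') s' S k).w
                (tkBranchOfRecord F N (FluctV N) θ.ν θ.τ9.M (gOfRecord₁₃ F N θ.toStage13Params p) p.K (WtOfRecord₁₃H F N θ p s') s' S k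
                  (fun ω => sect2Operand F N (FluctV N) p.K (settingOfRecord₁₃ F N θ.toStage13Params p) (θ.rzAt p s') s' t' E'
                    (UbgOfRecord₁₃CoP F N θ.toStage13Params p (k + 1) s') (S, fun j => (ω j).2) (fun j => (ω j).1))))
              (Function.update (baseCfg (k + 1) ((MeasurableEquiv.piEquivPiSubtypeProd (fun _ : PBond (F.P p.K) (k + 1) => SU N)
                  (· ∈ (Set.toFinite (bondsIn (k + 1) (s'.Ω (k + 1))ᶜ)).toFinset)).symm q)) k
                (Function.updateFinset ((baseCfg (V := FluctV N) (k + 1) ((MeasurableEquiv.piEquivPiSubtypeProd (fun _ : PBond (F.P p.K) (k + 1) => SU N)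
                  (· ∈ (Set.toFinite (bondsIn (k + 1) (s'.Ω (k + 1))ᶜ)).toFinset)).symm q)) k).1 (Set.toFinite (bondsIn k (s'.Ω (k + 1))ᶜ)).toFinset y,
                  ((baseCfg (V := FluctV N) (k + 1) ((MeasurableEquiv.piEquivPiSubtypeProd (fun _ : PBond (F.P p.K) (k + 1) => SU N)
                    (· ∈ (Set.toFinite (bondsIn (k + 1) (s'.Ω (k + 1))ᶜ)).toFinset)).symm q)) k).2))) :
    slotsTOfRecord F N θ.ν θ.τ9 (EOfRecord₁₃ F N θ.toStage13Params) (wOfRecord₉ F N θ.toStage9Params) θ.ppSel p (gOfRecord₁₃ F N θ.toStage13Params p) (k + 1) s'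
      =ᵐ[fieldMeasure (F.P p.K) (k + 1) (SU N)]
        sect2Slot F N (FluctV N) p.K (settingOfRecord₁₃ F N θ.toStage13Params p) (θ.rzAt p s') (WtOfRecord₁₃H F N θ p s') s' t' E'
          (UbgOfRecord₁₃CoP F N θ.toStage13Params p (k + 1) s') :=
  slotsTOfRecord₁₃H_succ_ae_eq_sect2Slot_of_innerSum_of_rows θ h.zhLaws p hkK (hdec := hdec) (hdec' := hdec') hk s' t' E' hζ hq hΦm
    (hG_at_record₁₃_of_provisos θ h p hkK s') hFm hin hinnerSum

/-- ★★★ **THE (O3′) DISJUNCTION OF `PresentChildObligations`, VERBATIM, `_of_provisos`**: the last conjunct of dag-n11-e's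
`…N11Sect3SupplyChainDefs.PresentChildObligations θ p k t tnew EkN s′` (with `t′ := graftAboveB k (t s′.init) (tnew s′)`, `E′ := EkN s′`; ANY `(t′, E′)` here) — right disjunct, the
`χ_{k+1}(s′)`-guard dropped — from `θ.Provisos₁₃CoPH F N`, the two residual-measurability rows, the operand row and the chart content.  NO `hint`, NO `hgm`, NO `hG`, NO `hZ`.
[cite: Balaban1988Convergent, Thm 2 p.263, §3 p.279, (3.24)–(3.25) p.270] -/
theorem slotsTOfRecord₁₃H_succ_O3_of_innerSum_of_provisos (θ : Stage13HParams F N) (h : θ.Provisos₁₃CoPH F N)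
    (p : B12.RunParams) {k : ℕ} (hkK : k < p.K)
    {hdec : DecidableEq (PBond (F.P p.K) k)} {hdec' : DecidableEq (PBond (F.P p.K) (k + 1))} (hk : k + 1 ≤ (F.P p.K).m + (F.P p.K).K)
    (s' : SeqOfRecord F θ.ν θ.τ9.M (gOfRecord₁₃ F N θ.toStage13Params p) p.K (k + 1))
    (t' : Sect2.TermValues (F.P p.K) (MatA N) (FluctV N) θ.τ9.M) (E' : ℝ)
    (hζ : ∀ (j : ℕ) (Y : Set (Site (F.P p.K) 0)), Measurable ((θ.zhAt p s').ζ0 j Y))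
    (hq : ∀ (j : ℕ) (Λ' : Set (Site (F.P p.K) 0)), Measurable ((θ.zhAt p s').quad j Λ'))
    (hΦm : ∀ S ∈ admSOfRecord F θ.ν θ.τ9.M (gOfRecord₁₃ F N θ.toStage13Params p) p.K (k + 1) s',
      Measurable (fun ω : MultiCfg (F.P p.K) (SU N) (FluctV N) =>
        sect2Operand F N (FluctV N) p.K (settingOfRecord₁₃ F N θ.toStage13Params p) (θ.rzAt p s') s' t' E'
          (UbgOfRecord₁₃CoP F N θ.toStage13Params p (k + 1) s') (S, fun j => (ω j).2) (fun j => (ω j).1)))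
    {Fᵢ : (↥(Set.toFinite (bondsIn k (s'.Ω (k + 1))ᶜ)).toFinset → SU N) ×
        ({c : PBond (F.P p.K) (k + 1) // c ∉ (Set.toFinite (bondsIn (k + 1) (s'.Ω (k + 1))ᶜ)).toFinset} → SU N) → ℝ} (hFm : Measurable Fᵢ)
    (hin : kernelTransport
        ((Measure.pi fun _ : ↥(Set.toFinite (bondsIn k (s'.Ω (k + 1))ᶜ)).toFinset => (HaarData.haar : Measure (SU N))).prod
          (Measure.pi fun _ : {b : PBond (F.P p.K) k // b ∉ (Set.toFinite (bondsIn k (s'.Ω (k + 1))ᶜ)).toFinset} => (HaarData.haar : Measure (SU N))))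
        ((Measure.pi fun _ : ↥(Set.toFinite (bondsIn k (s'.Ω (k + 1))ᶜ)).toFinset => (HaarData.haar : Measure (SU N))).prod
          (Measure.pi fun _ : {c : PBond (F.P p.K) (k + 1) // c ∉ (Set.toFinite (bondsIn (k + 1) (s'.Ω (k + 1))ᶜ)).toFinset} =>
            (HaarData.haar : Measure (SU N))))
        (fun q => (q.1, fun c : {c : PBond (F.P p.K) (k + 1) // c ∉ (Set.toFinite (bondsIn (k + 1) (s'.Ω (k + 1))ᶜ)).toFinset} =>
          (avOfRecord F N p.K k).avg
            ((MeasurableEquiv.piEquivPiSubtypeProd (fun _ : PBond (F.P p.K) k => SU N)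
              (· ∈ (Set.toFinite (bondsIn k (s'.Ω (k + 1))ᶜ)).toFinset)).symm q) c))
        ((fun U => wOfRecord₉ F N θ.toStage9Params p (gOfRecord₁₃ F N θ.toStage13Params p) k s' U ((avOfRecord F N p.K k).avg U) *
            (chiSeqOfRecord F N θ.ν θ.τ9.M (gOfRecord₁₃ F N θ.toStage13Params p) p.K k s'.init U *
              slotsOfRecord F N θ.ν θ.τ9 (EOfRecord₁₃ F N θ.toStage13Params) (wOfRecord₉ F N θ.toStage9Params) θ.ppSel p
                (gOfRecord₁₃ F N θ.toStage13Params p) k s'.init U)) ∘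
          ⇑(MeasurableEquiv.piEquivPiSubtypeProd (fun _ : PBond (F.P p.K) k => SU N)
            (· ∈ (Set.toFinite (bondsIn k (s'.Ω (k + 1))ᶜ)).toFinset)).symm)
      =ᵐ[(Measure.pi fun _ : ↥(Set.toFinite (bondsIn k (s'.Ω (k + 1))ᶜ)).toFinset => (HaarData.haar : Measure (SU N))).prod
          (Measure.pi fun _ : {c : PBond (F.P p.K) (k + 1) // c ∉ (Set.toFinite (bondsIn (k + 1) (s'.Ω (k + 1))ᶜ)).toFinset} =>
            (HaarData.haar : Measure (SU N)))] Fᵢ)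
    (hinnerSum : ∀ᵐ q ∂((Measure.pi fun _ : ↥(Set.toFinite (bondsIn (k + 1) (s'.Ω (k + 1))ᶜ)).toFinset => (HaarData.haar : Measure (SU N))).prod
          (Measure.pi fun _ : {c : PBond (F.P p.K) (k + 1) // c ∉ (Set.toFinite (bondsIn (k + 1) (s'.Ω (k + 1))ᶜ)).toFinset} =>
            (HaarData.haar : Measure (SU N)))),
      ∀ y : ↥(Set.toFinite (bondsIn k (s'.Ω (k + 1))ᶜ)).toFinset → SU N,
        avgRestrOfRecord F N p.K k (Set.toFinite (bondsIn k (s'.Ω (k + 1))ᶜ)).toFinset (Set.toFinite (bondsIn (k + 1) (s'.Ω (k + 1))ᶜ)).toFinset y = q.1 →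
        Fᵢ (y, q.2) =
          ∑ S ∈ admSOfRecord F θ.ν θ.τ9.M (gOfRecord₁₃ F N θ.toStage13Params p) p.K (k + 1) s',
            zetaOp (genDataOfRecord F N (FluctV N) θ.ν θ.τ9.M (gOfRecord₁₃ F N θ.toStage13Params p) p.K (WtOfRecord₁₃H F N θ p s') s' S k).ζ
              (aOp k (genDataOfRecord F N (FluctV N) θ.ν θ.τ9.M (gOfRecord₁₃ F N θ.toStage13Params p) p.K (WtOfRecord₁₃H F N θ p s') s' S k).sA
                (genDataOfRecord F N (FluctV N) θ.ν θ.τ9.M (gOfRecord₁₃ F N θ.toStage13Params p) p.K (WtOfRecord₁₃H F N θ p s') s' S k).w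
                (tkBranchOfRecord F N (FluctV N) θ.ν θ.τ9.M (gOfRecord₁₃ F N θ.toStage13Params p) p.K (WtOfRecord₁₃H F N θ p s') s' S k
                  (fun ω => sect2Operand F N (FluctV N) p.K (settingOfRecord₁₃ F N θ.toStage13Params p) (θ.rzAt p s') s' t' E'
                    (UbgOfRecord₁₃CoP F N θ.toStage13Params p (k + 1) s') (S, fun j => (ω j).2) (fun j => (ω j).1))))
              (Function.update (baseCfg (k + 1) ((MeasurableEquiv.piEquivPiSubtypeProd (fun _ : PBond (F.P p.K) (k + 1) => SU N)
                  (· ∈ (Set.toFinite (bondsIn (k + 1) (s'.Ω (k + 1))ᶜ)).toFinset)).symm q)) k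
                (Function.updateFinset ((baseCfg (V := FluctV N) (k + 1) ((MeasurableEquiv.piEquivPiSubtypeProd (fun _ : PBond (F.P p.K) (k + 1) => SU N)
                  (· ∈ (Set.toFinite (bondsIn (k + 1) (s'.Ω (k + 1))ᶜ)).toFinset)).symm q)) k).1 (Set.toFinite (bondsIn k (s'.Ω (k + 1))ᶜ)).toFinset y,
                  ((baseCfg (V := FluctV N) (k + 1) ((MeasurableEquiv.piEquivPiSubtypeProd (fun _ : PBond (F.P p.K) (k + 1) => SU N)
                    (· ∈ (Set.toFinite (bondsIn (k + 1) (s'.Ω (k + 1))ᶜ)).toFinset)).symm q)) k).2))) :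
    slotsTOfRecord F N θ.ν θ.τ9 (EOfRecord₁₃ F N θ.toStage13Params) (wOfRecord₉ F N θ.toStage9Params) θ.ppSel p
        (gOfRecord₁₃ F N θ.toStage13Params p) (k + 1) s' = 0 ∨
      ∀ᵐ V' ∂fieldMeasure (F.P p.K) (k + 1) (SU N),
        chiSeqOfRecord F N θ.ν θ.τ9.M (gOfRecord₁₃ F N θ.toStage13Params p) p.K (k + 1) s' V' ≠ 0 →
          slotsTOfRecord F N θ.ν θ.τ9 (EOfRecord₁₃ F N θ.toStage13Params) (wOfRecord₉ F N θ.toStage9Params) θ.ppSel p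
              (gOfRecord₁₃ F N θ.toStage13Params p) (k + 1) s' V' =
            sect2Slot F N (FluctV N) p.K (settingOfRecord₁₃ F N θ.toStage13Params p) (θ.rzAt p s') (WtOfRecord₁₃H F N θ p s') s' t' E'
              (UbgOfRecord₁₃CoP F N θ.toStage13Params p (k + 1) s') V' :=
  Or.inr ((slotsTOfRecord₁₃H_succ_ae_eq_sect2Slot_of_innerSum_of_provisos θ h p hkK (hdec := hdec) (hdec' := hdec') hk s' t' E' hζ hq hΦm hFm hin
    hinnerSum).mono fun _ hV' _ => hV')

end OnTheNose

end Summit.QuantumFields.YangMills.Theorems.BalabanUVNodesN11TStepGraphIntegrableOfProvisos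

end
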